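import Summits.Ventures.HSemireg.Pad4TowerCrossPhase

/-!
# Strengthen MEMO-03 companion — capacity scaling under dilation, typed against c4-1's `kFactor`

`kFactor Δ` (`C4StabilitySpec`, hsemireg-c4-1) is the letter-level `h⁰` factor of an effective balanced difference `Δ` under the
canonical Pic⁰ lift: `1` for `Δ = 0`, `gcd Δ` for `Δ ≠ 0` null (isotropic), `det Δ = Δα² − Δx² − Δy²` otherwise. MEMO-02 §3 stated
[pen] that under the dilation `D_m` Hall capacities grow: null `×m`, timelike `×m²`, zero `×1`. MEMO-03 §4 explains the factors as
CHARACTER COUNTS of the isogeny `[α]`, `|α|² = m`: per pair-factor `S = E₀²` the characters are `Ŝ[ᾱ]` (order `m²`), those on the null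
torus `B_F` of a fibration number `m`, and only the trivial one sits at `0` — so `det(mΔ) = m²·det Δ`, `gcd(mΔ) = m·gcd Δ`, `1 = 1` are
the identities «coloured unit-scale capacity = dilated capacity». This file proves the three scaling identities for `kFactor ∘ dilPt m`
(kernel), nothing more. SELF-CONTAINED: `kFactor` and `dilPt` below are VERBATIM copies of `C4StabilitySpec.kFactor` (c4-1) and
`StrengthenDilation.dilPt` (this seat) — the farm snapshot does not yet serve `Cruxes/` modules as imports, so the two definitions
are restated here instead of imported; when they are importable the copies are `rfl`-equal by construction. HONEST FRAMING: integer arithmetic on the letter model; no sheaf, no character group, no monad, no SOURCE, no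
SEED is constructed here; nothing toward 18881∕H2, HC_AV, HC_CM or HC. No proof placeholders, no new axioms, no instances, no notation.
-/

namespace Summit.HodgeConjecture.HodgeConjecture.Cruxes.BlochSeedDiscOne.StrengthenIsogeny

open Summit.Ventures.HSemireg.Pad4Tower

/-- VERBATIM copy of `C4Stability.kFactor` (`Cruxes/BlochSeedDiscOne/C4StabilitySpec.lean` l.33): the letter `h⁰` factor. -/
def kFactor (Δ : BPoint) : ℤ :=
  if Δ = (0, 0, 0) then 1
  else if Δ.2.1 ^ 2 + Δ.2.2 ^ 2 = Δ.1 ^ 2 then (Int.gcd (Int.gcd Δ.1 Δ.2.1 : ℤ) Δ.2.2 : ℤ)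
  else Δ.1 ^ 2 - Δ.2.1 ^ 2 - Δ.2.2 ^ 2

/-- VERBATIM copy of `StrengthenDilation.dilPt` (`Cruxes/BlochSeedDiscOne/StrengthenDilation.lean` l.34): the dilation on block points. -/
def dilPt (m : ℤ) (x : BPoint) : BPoint := (m * x.1, m * x.2.1, m * x.2.2)

variable {m : ℤ}

theorem dilPt_eq_zero_iff (hm : m ≠ 0) (Δ : BPoint) : dilPt m Δ = (0, 0, 0) ↔ Δ = (0, 0, 0) := by
  obtain ⟨a, b, c⟩ := Δ
  simp [dilPt, Prod.ext_iff, hm]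

theorem dilPt_null_iff (hm : m ≠ 0) (Δ : BPoint) :
    (dilPt m Δ).2.1 ^ 2 + (dilPt m Δ).2.2 ^ 2 = (dilPt m Δ).1 ^ 2 ↔ Δ.2.1 ^ 2 + Δ.2.2 ^ 2 = Δ.1 ^ 2 := by
  obtain ⟨a, b, c⟩ := Δ
  simp only [dilPt]
  rw [show (m * b) ^ 2 + (m * c) ^ 2 = m ^ 2 * (b ^ 2 + c ^ 2) by ring, show (m * a) ^ 2 = m ^ 2 * a ^ 2 by ring]
  exact ⟨fun h => mul_left_cancel₀ (pow_ne_zero 2 hm) h, fun h => by rw [h]⟩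

/-- zero difference: one character, capacity `1 = 1`. -/
theorem kFactor_dil_zero (m : ℤ) : kFactor (dilPt m (0, 0, 0)) = 1 := by
  simp [kFactor, dilPt]

/-- null difference `Δ ≠ 0`: `gcd(mΔ) = m · gcd Δ` (`m ≥ 1`) — the `m` characters on the null torus `B_F`. -/
theorem kFactor_dil_null (hm : 0 < m) (Δ : BPoint) (h0 : Δ ≠ (0, 0, 0)) (hnull : Δ.2.1 ^ 2 + Δ.2.2 ^ 2 = Δ.1 ^ 2) :
    kFactor (dilPt m Δ) = m * kFactor Δ := by
  have h0' : dilPt m Δ ≠ (0, 0, 0) := fun h => h0 ((dilPt_eq_zero_iff hm.ne' Δ).1 h)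
  have hnull' := (dilPt_null_iff hm.ne' Δ).2 hnull
  simp only [kFactor, h0, h0', hnull, hnull', if_false, if_true]
  obtain ⟨a, b, c⟩ := Δ
  simp only [dilPt]
  have h1 : ((Int.gcd (m * a) (m * b) : ℕ) : ℤ) = m * (Int.gcd a b : ℤ) := by
    rw [Int.gcd_mul_left]; push_cast; rw [abs_of_pos hm]
  rw [h1, Int.gcd_mul_left]; push_cast; rw [abs_of_pos hm]

/-- non-degenerate difference: `det(mΔ) = m² · det Δ` — the `m²` characters of `Ŝ[ᾱ]`. -/
theorem kFactor_dil_nondeg (hm : m ≠ 0) (Δ : BPoint) (hnd : Δ.2.1 ^ 2 + Δ.2.2 ^ 2 ≠ Δ.1 ^ 2) :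
    kFactor (dilPt m Δ) = m ^ 2 * kFactor Δ := by
  have h0 : Δ ≠ (0, 0, 0) := by rintro rfl; simp at hnd
  have h0' : dilPt m Δ ≠ (0, 0, 0) := fun h => h0 ((dilPt_eq_zero_iff hm Δ).1 h)
  have hnd' : ¬ ((dilPt m Δ).2.1 ^ 2 + (dilPt m Δ).2.2 ^ 2 = (dilPt m Δ).1 ^ 2) := fun h => hnd ((dilPt_null_iff hm Δ).1 h)
  simp only [kFactor, h0, h0', hnd, hnd', if_false]
  obtain ⟨a, b, c⟩ := Δ
  simp only [dilPt]
  ring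

/-- the `D_2 = [1+i]^*` instance of the three identities (characters `(ℤ∕2)²` per pair-factor: `4` in all, `2` on a null torus, `1` at zero):
`kFactor (D_2 Δ) = #characters(Δ) · kFactor Δ`. -/
theorem kFactor_dil_two (Δ : BPoint) :
    kFactor (dilPt 2 Δ) =
      (if Δ = (0, 0, 0) then 1 else if Δ.2.1 ^ 2 + Δ.2.2 ^ 2 = Δ.1 ^ 2 then 2 else 4) * kFactor Δ := by
  by_cases h0 : Δ = (0, 0, 0)
  · subst h0; rw [kFactor_dil_zero, if_pos rfl]; simp [kFactor]
  by_cases hnull : Δ.2.1 ^ 2 + Δ.2.2 ^ 2 = Δ.1 ^ 2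
  · rw [if_neg h0, if_pos hnull, kFactor_dil_null (by norm_num) Δ h0 hnull]
  · rw [if_neg h0, if_neg hnull, kFactor_dil_nondeg (by norm_num) Δ hnull]; norm_num

end Summit.HodgeConjecture.HodgeConjecture.Cruxes.BlochSeedDiscOne.StrengthenIsogeny
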